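import Summits.CriticalPhenomena.PercolationContinuityZ3.Theorems.Transplant.SkelFrmFrom1ReachHoldsQ3VPx
import HarnessLib

/-!
# GEN ROW (RULING D-Us V147b / Us-R1–R6 lead g22; WAVE-Us-MANIFEST v1.0 §5 — THE (C) COLUMN TOP AT THE TUPLE Px OF RECORD) «SkelFrmFrom1ReachHoldsQ3VNodePx» — the
# GENERALISED twin of «SkelFrmFrom1ReachHoldsQ3VNode»: **the budgeted corridor obligation of the GEN choice function of record at proxy radius `D`, at the tuple of
# record** (`gvPx/fvPx/PvPx/exPx/mxPx/cvPx/hvPx`, «SkelFrmFromBChoiceSlotsPx» p473802), K-floor `Kmin ≥ 160` (the Us-4 node takes `480`) — the (C) name the node reads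

builds on p205010 (kernel theorem, internal audit signed; external expert review pending) — nothing in this file uses p205010; the (C) column top of the four the Us-4 node
composes (RULING Us-R5 shape (a), p3 g27 precheck #5667); NOTHING about the OPEN node U_s (`SamePDropOfSkeletonFrmScaled₁`) is claimed until that node lands; no statement,
no `@[conjecture]`, def-free.  Lane `prim-bschramm`, seat `prim-bschramm-gen-1` g0 (GEN pen, (C) column, RULING Us-R3); helper file (`--supports
stmt-CriticalPhenomena-4575 --as helper`).  PROOF = U's «…ReachHoldsQ3VNode» at the raised index: the slot-robust top «…ReachHoldsQ3VPx» p475406 with its three floors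
discharged at `mkP(t, Dr) := KS.RK t Dr 0 + D` by U's `NegB.Hg_Q mkP (gxR0 mkP) (fxR mkP)` (box: `gvPx D` IS `gT mkP (gxQ mkP (gxR0 mkP) (fxR mkP))` at `Dr`, «SlotsPx»
`gvPx_at`, rfl) and by `NegB.le_exQ mkP (exRD mkP D)` ∘ «SlotsPx».`exRD_floors` (excess: `exPx D` IS `exQ mkP (exRD mkP D)`; the `+ D` long-window floor is `exRD`'s second
member, `ZD2 + 4` / `ZDYW + 4` are `exQ`'s) — lower bounds only (O-R).
[cite: KozmaNitzan2024, §4 Lemma 12 (pp. 23–25), p. 30 (Step IV)] [cite: BenjaminiSchramm1996, Conj. 4] [this work]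
-/

open scoped Classical

noncomputable section

namespace Summit.CriticalPhenomena.PercolationContinuityZ3.Theorems.Transplant

namespace PlanarSkeletonFrmFrom

open Literature.Probability.Percolation Literature.Probability.LatticeModels SimpleGraph
open SkelConc (Consts)

/-- **THE (C) COLUMN TARGET OF RECORD UNDER PROXIES AT THE TUPLE Px OF RECORD** (K-floor `Kmin ≥ 160` as a parameter — the Us-4 node takes `Kmin := 480`; served-region kit
index `0`, kit / corridor at the raised index `KS.RK t Dr 0 + D`; window `BSlot.small3`, cells `cvPx D` / `hvPx D`): for every proxy radius `D`,
`ReachHoldsRHNQFnLKPxAt LfQ Kmin (frmChoiceAllQ3VPx D (gvPx D) (fvPx D) (PvPx D) (SUS (exPx D) (mxPx D)) (cvPx D) (hvPx D) BSlot.small3)`.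
[cite: KozmaNitzan2024, §4 Lemma 12 (pp. 23–25), p. 30 (Step IV)] -/
theorem reachHoldsRHNQFnLKPxAt_frmChoiceAllQ3VPx_node (D Kmin : ℕ) (hKmin : 160 ≤ Kmin) :
    ReachHoldsRHNQFnLKPxAt NegB.LfQ Kmin
      (frmChoiceAllQ3VPx D (NegB.gvPx D) (NegB.fvPx D) (NegB.PvPx D) (NegB.SUS (NegB.exPx D) (NegB.mxPx D)) (NegB.cvPx D) (NegB.hvPx D) NegB.BSlot.small3) :=
  reachHoldsRHNQFnLKPxAt_frmChoiceAllQ3VPx_of_le D Kmin hKmin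
    (fun _ _ _ _ _ _ _ t _ Dr => NegB.Hg_Q (NegB.KS.RK t Dr 0 + D) (NegB.gxR0 (NegB.KS.RK t Dr 0 + D)) (NegB.fxR (NegB.KS.RK t Dr 0 + D)) Dr)
    (fun κ _ _ _ _ _ Φ t p Dr g f =>
      ⟨(NegB.exRD_floors κ Φ t p Dr (NegB.KS.RK t Dr 0 + D) D g f
          (NegB.le_exQ (NegB.KS.RK t Dr 0 + D) (NegB.exRD (NegB.KS.RK t Dr 0 + D) D) κ Φ t p Dr g f).2.2.2.2).2.1,
        (NegB.le_exQ (NegB.KS.RK t Dr 0 + D) (NegB.exRD (NegB.KS.RK t Dr 0 + D) D) κ Φ t p Dr g f).2.1⟩)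
    (fun κ _ _ _ _ _ Φ t p Dr g f =>
      ⟨(NegB.exRD_floors κ Φ t p Dr (NegB.KS.RK t Dr 0 + D) D g f
          (NegB.le_exQ (NegB.KS.RK t Dr 0 + D) (NegB.exRD (NegB.KS.RK t Dr 0 + D) D) κ Φ t p Dr g f).2.2.2.2).2.1,
        (NegB.le_exQ (NegB.KS.RK t Dr 0 + D) (NegB.exRD (NegB.KS.RK t Dr 0 + D) D) κ Φ t p Dr g f).2.2.1⟩)

end PlanarSkeletonFrmFrom

end Summit.CriticalPhenomena.PercolationContinuityZ3.Theorems.Transplant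

end
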